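import Summits.QuantumFields.YangMills.Theorems.BalabanUVNodesK0AxTangentSocketOntoOfSectC
import Summits.QuantumFields.YangMills.Theorems.BalabanUVNodesN07SectCRegimeOfRecordSmall
import HarnessLib

/-!
# NODE O · K0ᴬ — THE (R-a) ROAD AT THE FLAT SCHEME OF RECORD WITH SECT. C's ROWS DISCHARGED «IN THE SMALL»: ✓p826083's knit displayed the Sect. C package (`Regime H♭ 0 C^{𝔰𝔩} …`, `Prop4Hyp`,
# `a₃ ≤ a_C`, `hCreal`, `hCtr`); ✓`exists_sectCRegime_ofRecord` + ✓`exists_radius_cslRows` inhabit it at the guarded flat background for ALL small radii, so both analytic letters of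
# ✓`rootedReceipts_of_tokens_atScale_recordScheme` — and the whole road — now display only: N07's KNIT tokens, `RegimeTok`, «Sect. C radii small: `0 < a₃ ≤ ε_C ≤ t₀`», the `G′` row,
# `Delta2Tok ∧ Delta2SymmTok`, `0 < a`, `dom ∈ 𝓝 1`, the chart letter, (J-crit′)∕(J-cons′) ([15] Prop. 4 p. 292, Prop. 6 p. 295, (51)–(54) p. 285; [B9] (3.134); [I] p. 264)

Cell `pub-ymgap`, width seat `pub-ymgap-dag-n07-w3` (g27), CLAIM-13.  `--kind proof --supports stmt-QuantumFields-27238 --as helper`; count-neutral.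
[15] = [Balaban1985Variational]; [B9] = [Balaban1985BackgroundPropagators]; [I] = [Balaban1987RG1].

CONTENTS (`U₀ = 1`, `N = 2`, level `k + 1`; `t₀` depends on `F, K, k, Ω, levB`, the Landau `a` and the displayed `hpos♭`, `hQ` only).
* ★★★ `htok_and_hWtok_ofRecord_two_smallRadii` — `∃ t₀ > 0`: for all scheme data with `0 < a₃ ≤ ε_C ≤ t₀`, the `G′` row, the `Δ2` tokens, `RegimeTok`, `dom ∈ 𝓝 1` and the chart letter give
  `WAnalyticTok … ε_C a₃ ∧ ∀ᶠ B in 𝓝 0, S.LieTokAt (W_B)`.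
* ★★★★ `rootedReceipts_of_tokens_atScale_recordScheme_smallRadii` — the (R-a) road (✓p826083) under the same: (∀ a l, the four rooted receipts) ∧ TokP9reg♭ᵣ.

HONEST LABELS.  The Sect. C constants are EXISTENTIAL and NON-UNIFORM (per background and level; not Bałaban's `O(1)` Props 3–4); N07's KNIT tokens, Prop. 6's `RegimeTok`, the `G′` row, `0 < a`,
`dom ∈ 𝓝 1`, the chart letter and the dictionaries stay DISPLAYED; `N = 2`; K0ᴬ NOT closed; N07 NOT discharged; P0 ⟨26900⟩ OPEN; R4 is the conditional finite-𝕋⁴ rung only.  Nothing here is a claim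
about the Yang–Mills mass gap (`Summit.QuantumFields`): finite torus, fixed `ε`; nothing continuum ∕ OS ∕ Clay.
-/

set_option autoImplicit false

noncomputable section

open Filter Topology
open scoped BigOperators Matrix.Norms.L2Operator InnerProductSpace

namespace Summit.QuantumFields.YangMills.Theorems.K0AxTangentSocketOntoSmallRadii

open Literature.MathematicalPhysics.QuantumFieldTheory.Balaban1983to89
open Literature.MathematicalPhysics.QuantumFieldTheory.Balaban1983to89.T4Continuum (T4Family)
open Literature.MathematicalPhysics.QuantumFieldTheory.Balaban1983to89.Node00
open B12GaugeOrbits021 (OrbitRel)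
open B11Prop6Scheme (mapT Prop4Hyp)
open B11Eq174Chart (Regime)
open B9Eq311TracePairing (starW)
open B11Eq103H1Complex (BondL2K SiteL2K)
open B11Eq111FrakG (nabla115)
open B11Eq115Space (NegSize NegSup levWeight JetSup)
open B15DeterminingSets (MSField avgFamily atScale)
open NormedSpace (exp)
open Summit.QuantumFields.YangMills.Theorems.K0RecordFormatNames
open Summit.QuantumFields.YangMills.Theorems.K0AxRootGrad
open Summit.QuantumFields.YangMills.Theorems.K0AxCtabUniq
open Summit.QuantumFields.YangMills.Theorems.N07TraceSectorDefs (scalPartW)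
open Summit.QuantumFields.YangMills.Theorems.N07WAnalyticTokOfSectC (wAnalyticTok_of_sectCRegime)
open Summit.QuantumFields.YangMills.Theorems.N07LieTokAtUnitFieldTwo (eventually_lieTokAt_unitField_ofRecord_two_of_tok)
open Summit.QuantumFields.YangMills.Theorems.N07SchemeTokOfRecordTwoSmall (exists_radius_cslRows)
open Summit.QuantumFields.YangMills.Theorems.N07SectCRegimeOfRecordSmall (exists_sectCRegime_ofRecord)
open Summit.QuantumFields.YangMills.Theorems.K0AxTangentSocketOntoOfSectC (rootedReceipts_of_tokens_atScale_recordScheme_of_sectC)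

variable (F : T4Family) (θ : Stage13Params F 2) (k K : ℕ) [Fact (0 < (F.L : ℝ))] [Fact (0 < (F.P K).eta (k + 1))] [Fact (0 < c0Rec F K (k + 1))]
  [Fact (∀ c, 0 < wBRec F K (k + 1) c)]
  (Ω : ℕ → Set (Site (F.P K) 0)) (levB : PBond (F.P K) (k + 1) → ℕ) (a : ℝ)
  (hposb : ∀ x, x ≠ 0 → 0 < RCLike.re ⟪x, laplaceAOfRecord F 2 (k + 1) (1 : GaugeField (F.P K) 0 (SU 2))
    (QOfRecord F 2 (k + 1) (1 : GaugeField (F.P K) 0 (SU 2))) (QflatOfRecord F 2 (k + 1)) a x⟫_ℂ)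
  (hQ : Function.Surjective (QOfRecord F 2 (k + 1) (1 : GaugeField (F.P K) 0 (SU 2))))

set_option maxHeartbeats 1600000 in
/-- ★★★ **BOTH ANALYTIC LETTERS OF THE (R-a) ROAD, SECT. C IN THE SMALL**: `∃ t₀ > 0` (flat background, level `k + 1`) such that for every scheme datum with `0 < a₃ ≤ ε_C ≤ t₀`, the `G′` row, the
`Δ2` tokens, `RegimeTok`, `dom ∈ 𝓝 1` and the chart letter: `WAnalyticTok … ε_C a₃ ∧ ∀ᶠ B in 𝓝 0, S.LieTokAt (W_B)` (the guard at `1` is ✓`smallBelow_one`).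
[cite: Balaban1985Variational, Prop. 4 p.292, Prop. 6 p.295, (51)–(54) p.285, (15) p.280; Balaban1985BackgroundPropagators, (3.134) p.422] -/
theorem htok_and_hWtok_ofRecord_two_smallRadii :
    ∃ t₀ > 0, ∀ (dom : Set (GaugeField (F.P K) (k + 1) (SU 2)))
      (Gp : SiteL2K ℂ (F.P K).d (fun _ => (F.P K).sitesPerDir 0) (c0Rec F K (k + 1)) (WRec 2) →ₗ[ℂ]
        SiteL2K ℂ (F.P K).d (fun _ => (F.P K).sitesPerDir 0) (c0Rec F K (k + 1)) (WRec 2))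
      (Δ2 : BondL2K ℂ (F.P K).d (fun _ => (F.P K).sitesPerDir 0) (c0Rec F K (k + 1)) (WRec 2) →ₗ[ℂ]
        BondL2K ℂ (F.P K).d (fun _ => (F.P K).sitesPerDir 0) (c0Rec F K (k + 1)) (WRec 2))
      (hposπ : ∀ x, x ≠ 0 → 0 < RCLike.re ⟪x, laplaceAOfRecordAt F 2 (k + 1) (1 : GaugeField (F.P K) 0 (SU 2))
        (hessOpOfRecord128 F 2 (k + 1) (1 : GaugeField (F.P K) 0 (SU 2)) Gp (QflatOfRecord F 2 (k + 1)) Δ2)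
        (QOfRecord F 2 (k + 1) (1 : GaugeField (F.P K) 0 (SU 2))) (QflatOfRecord F 2 (k + 1)) a x⟫_ℂ) (εC B₀ C₄ a₃ j a𝔄 ε₄ : ℝ),
      0 < a₃ → a₃ ≤ εC → εC ≤ t₀ →
      (∀ s, Gp (starW (phiRec 2) s) = starW (phiRec 2) (Gp s)) → (∀ s, Gp (scalPartW 2 _ s) = scalPartW 2 _ (Gp s)) →
      Delta2Tok F 2 K (k + 1) Ω 1 levB a hposb hQ Δ2 → Delta2SymmTok F 2 K (k + 1) Ω 1 Δ2 →
      (bgSchemeOfRecord F 2 K (k + 1) Ω 1 dom levB Gp Δ2 a hposπ hposb hQ εC B₀ C₄ a₃ j a𝔄 ε₄).RegimeTok →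
      dom ∈ 𝓝 (1 : GaugeField (F.P K) (k + 1) (SU 2)) →
      (letI := θ.instVβ₁; letI := θ.instVβ₂; ∀ v : θ.Vβ, exp (θ.ρ8 v) ∈ Matrix.specialUnitaryGroup (Fin 2) ℂ) →
      WAnalyticTok F 2 K (k + 1) Ω 1 levB Gp a hposb hQ εC a₃ ∧
      letI := θ.instVβ₁; letI := θ.instVβ₂
      ∀ᶠ B in 𝓝 (0 : Fin (F.P K).d → Site (F.P K) (k + 1) → θ.Vβ),
        (bgSchemeOfRecord F 2 K (k + 1) Ω 1 dom levB Gp Δ2 a hposπ hposb hQ εC B₀ C₄ a₃ j a𝔄 ε₄).LieTokAt (unitField F θ k K B) := by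
  have hguard : SmallBelow (avOfRecord F 2 K) (k + 1) (1 : GaugeField (F.P K) 0 (SU 2)) :=
    Summit.QuantumFields.YangMills.BalabanUVNodes.N07ChartLineFactsS1.smallBelow_one F K (k + 1)
  obtain ⟨r, hr, hrows⟩ := exists_radius_cslRows F 2 K (k + 1) Ω (1 : GaugeField (F.P K) 0 (SU 2)) levB hguard
  obtain ⟨b, C₂, c₄, t₁, -, -, -, ht₁, hP, hReg⟩ := exists_sectCRegime_ofRecord F 2 K (k + 1) Ω (1 : GaugeField (F.P K) 0 (SU 2)) levB a hposb hQ hguard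
  refine ⟨min t₁ (r / 4), lt_min ht₁ (by positivity), fun dom Gp Δ2 hposπ εC B₀ C₄ a₃ j a𝔄 ε₄ ha₃ ha₃ε hεt hGpR hGpS hΔ hs hT hd hρ => ?_⟩
  have hεt₁ : εC ≤ t₁ := hεt.trans (min_le_left _ _)
  have hεr : εC + εC < r := by
    have := hεt.trans (min_le_right _ _)
    linarith
  have hεpos : 0 < εC := ha₃.trans_le ha₃ε
  have RC := hReg εC εC hεpos le_rfl hεt₁
  have hCreal : ∀ A : Space115Lit F 2 K (k + 1) Ω 1,
      ((JetSup.equiv _ _ (nabla115 ((F.P K).eta (k + 1)) (unitsOfRecord F 2 (1 : GaugeField (F.P K) 0 (SU 2))))).symm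
          (star (JetSup.equiv _ _ (nabla115 ((F.P K).eta (k + 1)) (unitsOfRecord F 2 (1 : GaugeField (F.P K) 0 (SU 2)))) A)) : Space115Lit F 2 K (k + 1) Ω 1) = A →
      ‖A‖ ≤ εC + εC → ((NegSup.equiv _ _).symm (star (NegSup.equiv _ _ (CslOfRecord F 2 K (k + 1) Ω 1 levB A))) :
        NegSize (F.L : ℝ) ((F.P K).eta (k + 1)) levB 0 (Matrix (Fin 2) (Fin 2) ℂ)) = CslOfRecord F 2 K (k + 1) Ω 1 levB A :=
    fun A hA hn => (hrows A (hn.trans_lt hεr) hA).1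
  have hCtr : ∀ A : Space115Lit F 2 K (k + 1) Ω 1,
      ((JetSup.equiv _ _ (nabla115 ((F.P K).eta (k + 1)) (unitsOfRecord F 2 (1 : GaugeField (F.P K) 0 (SU 2))))).symm
          (star (JetSup.equiv _ _ (nabla115 ((F.P K).eta (k + 1)) (unitsOfRecord F 2 (1 : GaugeField (F.P K) 0 (SU 2)))) A)) : Space115Lit F 2 K (k + 1) Ω 1) = A →
      (∀ b', (JetSup.equiv _ _ (nabla115 ((F.P K).eta (k + 1)) (unitsOfRecord F 2 (1 : GaugeField (F.P K) 0 (SU 2)))) A b').trace = 0) →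
      ‖A‖ ≤ εC + εC → ∀ c, (NegSup.equiv _ _ (CslOfRecord F 2 K (k + 1) Ω 1 levB A) c).trace = 0 :=
    fun A hA _ hn => (hrows A (hn.trans_lt hεr) hA).2
  exact ⟨wAnalyticTok_of_sectCRegime F 2 K (k + 1) Ω 1 levB Gp a hposb hQ εC a₃ RC hP ha₃ε,
    eventually_lieTokAt_unitField_ofRecord_two_of_tok F θ k K Ω dom levB a hposπ hposb hQ εC B₀ C₄ a₃ j a𝔄 ε₄ RC hCreal hCtr hGpR hGpS hΔ hs hP ha₃ε hT hd hρ⟩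

set_option maxHeartbeats 1600000 in
/-- ★★★★ **THE (R-a) ROAD AT THE FLAT SCHEME OF RECORD, SECT. C IN THE SMALL** (`k + 2 ≤ m + K`): `∃ t₀ > 0` such that for every scheme datum with `0 < a₃ ≤ ε_C ≤ t₀`, under N07's KNIT tokens,
`RegimeTok`, `0 < a`, the `G′` row, the `Δ2` tokens, `dom ∈ 𝓝 1`, the chart letter and (J-crit′)∕(J-cons′): (∀ a l, the four rooted receipts) ∧ TokP9reg♭ᵣ — ✓`rootedReceipts_of_tokens_atScale_recordScheme_of_sectC`
with its Sect. C package inhabited by ✓`exists_sectCRegime_ofRecord` ∕ ✓`exists_radius_cslRows`. [cite: Balaban1985Variational, Prop. 4 p.292, Prop. 6 p.295, Prop. 9 p.309, (15) p.280;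
Balaban1985BackgroundPropagators, (3.134) p.422; Balaban1987RG1, p.264; Balaban1988Convergent, (2.10)–(2.13) pp.256–257] -/
theorem rootedReceipts_of_tokens_atScale_recordScheme_smallRadii (hk2 : k + 2 ≤ (F.P K).m + (F.P K).K) :
    ∃ t₀ > 0, ∀ (dom : Set (GaugeField (F.P K) (k + 1) (SU 2)))
      (Gp : SiteL2K ℂ (F.P K).d (fun _ => (F.P K).sitesPerDir 0) (c0Rec F K (k + 1)) (WRec 2) →ₗ[ℂ]
        SiteL2K ℂ (F.P K).d (fun _ => (F.P K).sitesPerDir 0) (c0Rec F K (k + 1)) (WRec 2))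
      (Δ2 : BondL2K ℂ (F.P K).d (fun _ => (F.P K).sitesPerDir 0) (c0Rec F K (k + 1)) (WRec 2) →ₗ[ℂ]
        BondL2K ℂ (F.P K).d (fun _ => (F.P K).sitesPerDir 0) (c0Rec F K (k + 1)) (WRec 2))
      (hposπ : ∀ x, x ≠ 0 → 0 < RCLike.re ⟪x, laplaceAOfRecordAt F 2 (k + 1) (1 : GaugeField (F.P K) 0 (SU 2))
        (hessOpOfRecord128 F 2 (k + 1) (1 : GaugeField (F.P K) 0 (SU 2)) Gp (QflatOfRecord F 2 (k + 1)) Δ2)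
        (QOfRecord F 2 (k + 1) (1 : GaugeField (F.P K) 0 (SU 2))) (QflatOfRecord F 2 (k + 1)) a x⟫_ℂ) (εC B₀ C₄ a₃ j a𝔄 ε₄ : ℝ)
      (S : BgSchemeOnLit F 2 K (k + 1) Ω 1), S = bgSchemeOfRecord F 2 K (k + 1) Ω 1 dom levB Gp Δ2 a hposπ hposb hQ εC B₀ C₄ a₃ j a𝔄 ε₄ →
      0 < a₃ → a₃ ≤ εC → εC ≤ t₀ → S.RegimeTok → 0 < a𝔄 →
      (∀ s, Gp (starW (phiRec 2) s) = starW (phiRec 2) (Gp s)) → (∀ s, Gp (scalPartW 2 _ s) = scalPartW 2 _ (Gp s)) →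
      Delta2Tok F 2 K (k + 1) Ω 1 levB a hposb hQ Δ2 → Delta2SymmTok F 2 K (k + 1) Ω 1 Δ2 →
      dom ∈ 𝓝 (1 : GaugeField (F.P K) (k + 1) (SU 2)) →
      (letI := θ.instVβ₁; letI := θ.instVβ₂; ∀ v : θ.Vβ, NormedSpace.exp (θ.ρ8 v) ∈ Matrix.specialUnitaryGroup (Fin 2) ℂ) →
      ∀ (Kc : GaugeField (F.P K) (k + 1) (SU 2) → Set (Space115Lit F 2 K (k + 1) Ω 1)),
      (∀ V ∈ S.dom, ∀ A ∈ Kc V, S.chart V A ∈ bgReg F 2 K (k + 1) θ.εbg ∧ Averaging.iter (avOfRecord F 2 K) (k + 1) (S.chart V A) = V) →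
      (∀ V ∈ S.dom, ∀ U : GaugeField (F.P K) 0 (SU 2), U ∈ bgReg F 2 K (k + 1) θ.εbg →
        Averaging.iter (avOfRecord F 2 K) (k + 1) U = V → ∃ A ∈ Kc V, OrbitRel (k + 1) (S.chart V A) U) →
      (∀ V ∈ S.dom, ∀ A ∈ Kc V, IsMinOn (wilsonAction4 ∘ S.chart V) (Kc V) A → ‖A‖ ≤ S.ε₄ ∧ mapT (S.𝒢 V) 0 (S.W V) (S.J V) (S.𝔄 V) A = A) →
      (∀ V ∈ S.dom, S.sol V ∈ Kc V) → (∀ V ∈ S.dom, IsMinOn (wilsonAction4 ∘ S.chart V) (Kc V) (S.sol V)) →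
      FlatCritDictionary F k K (msChart F 2 K (k + 1) (atScale (k + 1)) (avgFamily (avOfRecord F 2 K) 1) (1 : GaugeField (F.P K) 0 (SU 2))) →
      FlatConsDictionary F θ k K (msChart F 2 K (k + 1) (atScale (k + 1)) (avgFamily (avOfRecord F 2 K) 1) (1 : GaugeField (F.P K) 0 (SU 2)))
        (fun B => msChart F 2 K (k + 1) (atScale (k + 1)) (avgFamily (avOfRecord F 2 K) 1) (1 : GaugeField (F.P K) 0 (SU 2)) (S.lieExpo (unitField F θ k K B))) →
      (∀ (a : θ.ιβ) (l : RespLabel F k K),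
        RootedResponseCriticalModGaugeAt F θ k K a l ∧ RootedResponseOrbitAt F θ k K a l ∧
          RootedResponseInvCriticalAt F θ k K a l ∧ RootedResponseConstraintModGaugeAt F θ k K a l) ∧
      letI := θ.instVβ₁; letI := θ.instVβ₂
      ContDiffAt ℝ 2 (fun B : Fin (F.P K).d → Site (F.P K) (k + 1) → θ.Vβ =>
        fun (b : PBond (F.P K) 0) (i i' : Fin 2) => ((recordBgField F θ k K B b : SU 2) : Matrix (Fin 2) (Fin 2) ℂ) i i') 0 := by
  have hguard : SmallBelow (avOfRecord F 2 K) (k + 1) (1 : GaugeField (F.P K) 0 (SU 2)) :=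
    Summit.QuantumFields.YangMills.BalabanUVNodes.N07ChartLineFactsS1.smallBelow_one F K (k + 1)
  obtain ⟨r, hr, hrows⟩ := exists_radius_cslRows F 2 K (k + 1) Ω (1 : GaugeField (F.P K) 0 (SU 2)) levB hguard
  obtain ⟨b, C₂, c₄, t₁, -, -, -, ht₁, hP, hReg⟩ := exists_sectCRegime_ofRecord F 2 K (k + 1) Ω (1 : GaugeField (F.P K) 0 (SU 2)) levB a hposb hQ hguard
  refine ⟨min t₁ (r / 4), lt_min ht₁ (by positivity), fun dom Gp Δ2 hposπ εC B₀ C₄ a₃ j a𝔄 ε₄ S hS ha₃ ha₃ε hεt hT ha𝔄 hGpR hGpS hΔ hs hd hρ Kc range covers sol_of_isMinOn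
    star_mem star_isMinOn Jcrit Jcons => ?_⟩
  have hεt₁ : εC ≤ t₁ := hεt.trans (min_le_left _ _)
  have hεr : εC + εC < r := by
    have := hεt.trans (min_le_right _ _)
    linarith
  have hεpos : 0 < εC := ha₃.trans_le ha₃ε
  have RC := hReg εC εC hεpos le_rfl hεt₁
  exact rootedReceipts_of_tokens_atScale_recordScheme_of_sectC F θ k K hk2 Ω dom levB Gp Δ2 a hposπ hposb hQ εC B₀ C₄ a₃ j a𝔄 ε₄ S hS hT ha𝔄 RC hP ha₃ε
    (fun A hA hn => (hrows A (hn.trans_lt hεr) hA).1) (fun A hA _ hn => (hrows A (hn.trans_lt hεr) hA).2) hGpR hGpS hΔ hs hd hρ Kc range covers sol_of_isMinOn star_mem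
    star_isMinOn Jcrit Jcons

end Summit.QuantumFields.YangMills.Theorems.K0AxTangentSocketOntoSmallRadii

end
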